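import Mathlib
import HarnessLib

/-!
# Zero-mass Fekete ladder (line `Sketch-plus-wall-quotient-ladder`, stub S1 `stub_ladder`)

What: stub `stub_ladder` (S1) of the line `Sketch-plus-wall-quotient-ladder` for the crux
`SubPtolemyFloor` (item stmt-CriticalPhenomena-15703, route `SubPtolemyInterlacing`). Pure real
analysis, no lattice input: for `g : ℕ → ℝ` with a polynomial floor `c₀ n^{-b} ≤ g(n)` (`n ≥ 1`) and
approximate submultiplicativity at the doubling scale `g(2n+2) ≤ C n^p g(n)²` (`n ≥ 1`, `p ≥ 0`,
`C > 0`), the floor improves to `c n^{-p} ≤ g(n)` (`n ≥ 1`) with the SAME exponent `p`.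

Proof (log-space bootstrap, uniform in `n`; no dyadic sums). The floor makes `g(n) > 0` for `n ≥ 1`,
so pass to `L(n) := log g(n)` and `ℓ(n) := log n ≥ 0`: the hypotheses read
`log c₀ - b' ℓ(n) ≤ L(n)` with `b' := max b 0 ≥ 0`, `L(2n+2) ≤ log C + p ℓ(n) + 2 L(n)`, and the
ladder `n ↦ 2n+2` costs `ℓ(2n+2) ≤ κ + ℓ(n)` with `κ := log 4 ≥ 0` (`2n+2 ≤ 4n`).
KEY LEMMA `ladder_bootstrap` (abstract sequences `L`, `ℓ`): with `a := -(p+b')κ - log C` and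
`β := log c₀ - a`, for every `j : ℕ` and every `n ≥ 1`,
`a - p ℓ(n) + 2^{-j} (β - b' ℓ(n)) ≤ L(n)`; `j = 0` is the floor (`p ℓ(n) ≥ 0`), and `j → j+1`
applies the claim at `2n+2`, the submultiplicativity at `n`, halves, and absorbs the doubling cost
`p κ + 2^{-j} b' κ ≤ (p + b') κ` into `a`. Letting `j → ∞` at fixed `n` (`2^{-j} → 0`) gives
`a - p ℓ(n) ≤ L(n)`, i.e. `e^{a} n^{-p} ≤ g(n)`: the constant is `c := e^{a} = (4^{p+b'} C)⁻¹`.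
Mathlib only.
-/

noncomputable section

namespace Summit.CriticalPhenomena.Ising3DConformalLimit.SubPtolemyFloorPlusWall

/-! ## Log-space bookkeeping -/

/-- Cost of one rung of the ladder `n ↦ 2n + 2` in the logarithm: `log (2n+2) ≤ log 4 + log n` for
`n ≥ 1` (since `2n + 2 ≤ 4n`). [folklore] -/
theorem ladder_log_two_mul_add_two_le {n : ℕ} (hn : 1 ≤ n) :
    Real.log ((2 * n + 2 : ℕ) : ℝ) ≤ Real.log 4 + Real.log n := by
  have hn1 : (1 : ℝ) ≤ n := by exact_mod_cast hn
  have hn0 : (n : ℝ) ≠ 0 := by positivity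
  have hpos : (0 : ℝ) < ((2 * n + 2 : ℕ) : ℝ) := by positivity
  have hle : ((2 * n + 2 : ℕ) : ℝ) ≤ 4 * n := by push_cast; linarith
  rw [← Real.log_mul (by norm_num) hn0]
  exact Real.log_le_log hpos hle

/-- **Log-space bootstrap (the zero-mass Fekete ladder, additive form).** For real sequences `L`, `ℓ`
with `ℓ ≥ 0`, a rung cost `ℓ(2n+2) ≤ κ + ℓ(n)` (`κ ≥ 0`), a linear floor `c - b ℓ(n) ≤ L(n)` (`b ≥ 0`)
and the approximate subadditivity `L(2n+2) ≤ K + p ℓ(n) + 2 L(n)` (`p ≥ 0`), all for `n ≥ 1`, one has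
`-(p+b)κ - K - p ℓ(n) ≤ L(n)` for all `n ≥ 1`. Proof: with `a := -(p+b)κ - K`, `β := c - a`, the
bound `a - p ℓ(n) + 2^{-j}(β - b ℓ(n)) ≤ L(n)` holds for all `j` by induction (halve the bound at
`2n+2`), and `2^{-j} → 0`. [folklore] -/
theorem ladder_bootstrap (L ℓ : ℕ → ℝ) {p K c b κ : ℝ} (hp : 0 ≤ p) (hb : 0 ≤ b) (hκ : 0 ≤ κ)
    (hℓ0 : ∀ n : ℕ, 1 ≤ n → 0 ≤ ℓ n)
    (hℓ : ∀ n : ℕ, 1 ≤ n → ℓ (2 * n + 2) ≤ κ + ℓ n)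
    (hfloor : ∀ n : ℕ, 1 ≤ n → c - b * ℓ n ≤ L n)
    (hsub : ∀ n : ℕ, 1 ≤ n → L (2 * n + 2) ≤ K + p * ℓ n + 2 * L n) :
    ∀ n : ℕ, 1 ≤ n → -(p + b) * κ - K - p * ℓ n ≤ L n := by
  -- opaque names for the two bookkeeping constants
  obtain ⟨a, ha⟩ : ∃ a : ℝ, a = -(p + b) * κ - K := ⟨_, rfl⟩
  obtain ⟨β, hβ⟩ : ∃ β : ℝ, β = c - a := ⟨_, rfl⟩
  -- the claim, by induction on the number `j` of halvings, uniformly in `n`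
  have claim : ∀ j : ℕ, ∀ n : ℕ, 1 ≤ n →
      a - p * ℓ n + (1 / 2 : ℝ) ^ j * (β - b * ℓ n) ≤ L n := by
    intro j
    induction j with
    | zero =>
      intro n hn
      have h1 := hfloor n hn
      have h2 : 0 ≤ p * ℓ n := mul_nonneg hp (hℓ0 n hn)
      rw [pow_zero, one_mul]
      linarith
    | succ j ih =>
      intro n hn
      have h1 := ih (2 * n + 2) (by omega)
      have h2 := hsub n hn
      have h3 : 0 ≤ κ + ℓ n - ℓ (2 * n + 2) := by linarith [hℓ n hn]
      have ht0 : (0 : ℝ) ≤ (1 / 2 : ℝ) ^ j := by positivity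
      have ht1 : (1 / 2 : ℝ) ^ j ≤ 1 := pow_le_one₀ (by norm_num) (by norm_num)
      have h4 : 0 ≤ p * (κ + ℓ n - ℓ (2 * n + 2)) := mul_nonneg hp h3
      have h5 : 0 ≤ (1 / 2 : ℝ) ^ j * b * (κ + ℓ n - ℓ (2 * n + 2)) :=
        mul_nonneg (mul_nonneg ht0 hb) h3
      have h6 : 0 ≤ (1 - (1 / 2 : ℝ) ^ j) * b * κ :=
        mul_nonneg (mul_nonneg (by linarith) hb) hκ
      rw [pow_succ]
      linarith
  -- let `j → ∞` at fixed `n`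
  intro n hn
  have hlim : Filter.Tendsto (fun j : ℕ => a - p * ℓ n + (1 / 2 : ℝ) ^ j * (β - b * ℓ n))
      Filter.atTop (nhds (a - p * ℓ n + 0 * (β - b * ℓ n))) :=
    tendsto_const_nhds.add
      ((tendsto_pow_atTop_nhds_zero_of_lt_one (by norm_num) (by norm_num)).mul_const _)
  have key := le_of_tendsto' hlim fun j => claim j n hn
  rw [zero_mul, add_zero] at key
  linarith

/-! ## The stub -/

/-- **S1 — zero-mass Fekete ladder (dyadic, one-sided).** For a real sequence with a polynomial floor
`c₀ n^{-b} ≤ g(n)` (`n ≥ 1`), approximate submultiplicativity at the doubling scale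
`g(2n+2) ≤ C n^p g(n)²` (`n ≥ 1`) with `p ≥ 0`, `C > 0` gives the power floor `c n^{-p} ≤ g(n)`
(`n ≥ 1`) with the same exponent `p`; explicitly `c = (4^{p + max b 0} C)⁻¹`. Proof: take logarithms
(`g > 0` by the floor) and apply `ladder_bootstrap` with `L = log ∘ g`, `ℓ = log`, `κ = log 4`,
`K = log C`, exponent `max b 0`; exponentiate. [folklore] -/
theorem stub_ladder :
    ∀ (g : ℕ → ℝ) (p C : ℝ), 0 ≤ p → 0 < C →
      (∃ c₀ b : ℝ, 0 < c₀ ∧ ∀ n : ℕ, 1 ≤ n → c₀ * (n : ℝ) ^ (-b) ≤ g n) →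
      (∀ n : ℕ, 1 ≤ n → g (2 * n + 2) ≤ C * (n : ℝ) ^ p * g n ^ 2) →
      ∃ c : ℝ, 0 < c ∧ ∀ n : ℕ, 1 ≤ n → c * (n : ℝ) ^ (-p) ≤ g n := by
  intro g p C hp hC hfloor hsub
  obtain ⟨c₀, b, hc₀, hfl⟩ := hfloor
  -- `g > 0` on `n ≥ 1`, from the polynomial floor
  have hpos : ∀ n : ℕ, 1 ≤ n → 0 < g n := by
    intro n hn
    have hn0 : (0 : ℝ) < n := by exact_mod_cast hn
    exact (mul_pos hc₀ (Real.rpow_pos_of_pos hn0 _)).trans_le (hfl n hn)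
  -- log form of the floor, with the nonnegative exponent `max b 0`
  have hfloorLog : ∀ n : ℕ, 1 ≤ n →
      Real.log c₀ - max b 0 * Real.log n ≤ Real.log (g n) := by
    intro n hn
    have hn0 : (0 : ℝ) < n := by exact_mod_cast hn
    have hl0 : 0 ≤ Real.log (n : ℝ) := Real.log_nonneg (by exact_mod_cast hn)
    have h1 : Real.log (c₀ * (n : ℝ) ^ (-b)) ≤ Real.log (g n) :=
      Real.log_le_log (mul_pos hc₀ (Real.rpow_pos_of_pos hn0 _)) (hfl n hn)
    rw [Real.log_mul hc₀.ne' (Real.rpow_pos_of_pos hn0 _).ne', Real.log_rpow hn0] at h1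
    have h2 : b * Real.log n ≤ max b 0 * Real.log n :=
      mul_le_mul_of_nonneg_right (le_max_left _ _) hl0
    linarith
  -- log form of the approximate submultiplicativity
  have hsubLog : ∀ n : ℕ, 1 ≤ n →
      Real.log (g (2 * n + 2)) ≤ Real.log C + p * Real.log n + 2 * Real.log (g n) := by
    intro n hn
    have hn0 : (0 : ℝ) < n := by exact_mod_cast hn
    have hg := hpos n hn
    have h1 : Real.log (g (2 * n + 2)) ≤ Real.log (C * (n : ℝ) ^ p * g n ^ 2) :=
      Real.log_le_log (hpos _ (by omega)) (hsub n hn)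
    rw [Real.log_mul (mul_pos hC (Real.rpow_pos_of_pos hn0 _)).ne' (pow_pos hg 2).ne',
      Real.log_mul hC.ne' (Real.rpow_pos_of_pos hn0 _).ne', Real.log_rpow hn0,
      Real.log_pow] at h1
    push_cast at h1
    linarith
  -- the bootstrap in log space
  have key : ∀ n : ℕ, 1 ≤ n →
      -(p + max b 0) * Real.log 4 - Real.log C - p * Real.log n ≤ Real.log (g n) :=
    ladder_bootstrap (fun n => Real.log (g n)) (fun n : ℕ => Real.log n) hp (le_max_right b 0)
      (Real.log_nonneg (by norm_num)) (fun n hn => Real.log_nonneg (by exact_mod_cast hn))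
      (fun _ hn => ladder_log_two_mul_add_two_le hn) hfloorLog hsubLog
  refine ⟨Real.exp (-(p + max b 0) * Real.log 4 - Real.log C), Real.exp_pos _, fun n hn => ?_⟩
  have hn0 : (0 : ℝ) < n := by exact_mod_cast hn
  have h := key n hn
  calc Real.exp (-(p + max b 0) * Real.log 4 - Real.log C) * (n : ℝ) ^ (-p)
      = Real.exp (-(p + max b 0) * Real.log 4 - Real.log C + Real.log n * -p) := by
        rw [Real.rpow_def_of_pos hn0, Real.exp_add]
    _ ≤ Real.exp (Real.log (g n)) := Real.exp_le_exp.2 (by linarith)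
    _ = g n := Real.exp_log (hpos n hn)

end Summit.CriticalPhenomena.Ising3DConformalLimit.SubPtolemyFloorPlusWall

end
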